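import Summits.QuantumAdvantage.QuantumAdvantage.Theorems.WhiteBoxWalkWbwThesis

/-!
# SKELETON (final) — crux `WbwThesis` (stmt-QuantumAdvantage-2238), line `Sketch` (lead prover)

`WbwThesis` (X) ⟸ `FactoringAssumption`, fully landed EXCEPT the conjecture:

* six of the seven registered stubs are tree theorems — `stub_bridge` (Theorems/WhiteBoxWalkWbwThesisBridge.lean,
  p92048), `stub_canon` (…Canon.lean, p92545), `stub_fPQ_polyTime` (…FPQPolyTime.lean, p93174), `stub_extract`
  (…Extract.lean, p94068), `stub_assemble` (…Assemble.lean, p94871), `stub_weakOW` (…WeakOWDensity p95341,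
  …WeakOWAdversary p95676, …WeakOW p95860);
* the composition is the tree theorem `wbwThesis_of_factoringAssumption : FactoringAssumption → WbwThesis`
  (Theorems/WhiteBoxWalkWbwThesis.lean, with `isOneWay_genPQ` and the unconditional clause (Q) `clauseQ_genPQ`);
* the ONLY `sorry` is `stub_factoring` — `FactoringAssumption` ITSELF (Theorems/FactoringAssumption.lean,
  `@[conjecture]`, Goldreich 2001 §2.2.4.1): conjecture-grade like X, never to be closed by a prover
  (a proof gives `WeakOWFExist`, hence `P ≠ NP`, inside the tree). Outcome of the line: `promote-stub`.

Objects: Theorems/WhiteBoxWalkDefs.lean (p86959). Choice and reshaping: Cruxes/WbwThesis/PICKED.md.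
-/

noncomputable section

set_option linter.dupNamespace false -- D-0017: single-problem summit ⇒ `QuantumAdvantage.QuantumAdvantage` by design

namespace Summit.QuantumAdvantage.QuantumAdvantage.Theorems.WhiteBoxWalk

open Summit.QuantumAdvantage.QuantumAdvantage.Theses.WhiteBoxWalk (WbwThesis)
open Summit.QuantumAdvantage.QuantumAdvantage.Theorems (FactoringAssumption)

/-- STUB (THE CONJECTURE). The standard factoring assumption — conjecture-grade, registered as the
obligation `Theorems/FactoringAssumption.lean`; it is NOT expected to be closed (a proof would give
`P ≠ NP`): the line's deliverable is the tree theorem `wbwThesis_of_factoringAssumption`. -/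
theorem stub_factoring : FactoringAssumption := by
  sorry

/-- The composition concluding the crux BY NAME, modulo the one remaining stub (the conjecture):
the tree's conditional theorem applied to it. -/
theorem WbwThesis_of : WbwThesis :=
  wbwThesis_of_factoringAssumption stub_factoring

end Summit.QuantumAdvantage.QuantumAdvantage.Theorems.WhiteBoxWalk

end
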